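import Mathlib
import HarnessLib
import Summits.Langlands.Statement
import Summits.Langlands.Langlands.Theses.DepthPrimeSplit
import Summits.Langlands.Langlands.Theses.AuxiliaryLevelSplit
import Summits.Langlands.Langlands.Theses.PrimeSwitchSplit
import Summits.Langlands.Langlands.Theorems.TransientLevelSplitLevelFiniteness
import Summits.Langlands.Langlands.Theorems.IwahoriTransientGalois
import Summits.Langlands.Langlands.Theorems.IwahoriTransientRoots

/-!
# WeakFernSplit — lens-3 gen 29 node of the cell `decomp-langlands` (planner-decomp-langlands-lens-3-g29-0, 2026-08-31)

TARGET (by name): FERN = `Theses.DepthPrimeSplit.FernSpread` (stmt-Langlands-25024; reduced to route-Langlands-AuxiliaryLevelSplit = G ∧ U, U =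
`AuxiliaryLevelSplit.LevelFiniteness` stmt-Langlands-27042 the lineage's declared residual), with its DPS sibling CLASS = `DepthPrimeSplit.Classicality` (25026).
FERN(ρ): H1 «ONE L-algebraic cuspidal π₁ is 1-close to ρ a.e.» ⟹ C «ONE finite S and, for every radius r, ONE cuspidal π_r r-close to ρ at every v ∉ S».
Gens 20–28 (G/U, U₁/U₂, SSH/ILC, BNS/NBC, AUXB/BNC) all kept C typed with GENUINE eigenforms π_r, and every node carries the same leaf «IDEA-NEEDED: weak ⟹ strong
eigenform lifting modulo ℓ^m at free weight» (Chen–Kiming–Wiese arXiv:1105.1918 p. 14: «we do not know whether strong and weak at a fixed level prime-to-p coincide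
when the weight is allowed to vary»).  THIS node removes that artefact at its source.
THE ONE TRANSLATION (lens-3's single EQUIV) = the DICTIONARY eigenform-valued ↦ HECKE-ALGEBRA-valued approximability: C_w «WEAKLY pro-automorphic of bounded
level» (`IsWeaklyProAutomorphic`): ONE finite S such that for every r > 0 a FINITE cuspidal family π_1 … π_k of tame level S has EVERY 𝒪-polynomial relation among
its unramified Hecke eigenvalues (Satake–Frobenius coefficients at v ∉ S, 𝒪 = 𝒪_{ℚ̄_ℓ}) satisfied by the Frobenius characteristic polynomials of ρ up to r — ρ mod
{|·| < r} is an 𝒪-algebra point of the Hecke algebra 𝕋(π_1 ⊕ … ⊕ π_k) = a dc-WEAK eigenform (CKW Def. 1 p. 3, §2.2: 𝕋 of a finite family) = ρ in the ℓ-adic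
ZARISKI CLOSURE of automorphic points (Emerton, local-global compatibility, §1.2 p. 3: «promodular»).  Typed construction-free with `MvPolynomial` over the valuation
ring (no ρ_π, no eigenvariety).  Certified: C ⟹ C_w (`weakly_of_pro`: ultrametric estimate `valuation_eval₂_sub_lt` + integrality `valuation_coeff_charpoly_le_one`).
SPLIT BENEATH (`fernSpread_iff_weakPieces`, modulo NOTHING):        FERN ⟺ HeckeFern ∧ WeakToStrongFern
 • HF `HeckeFern` : H1 ⟹ C_w — the INFINITE-FERN / big R = 𝕋 statement read at the point ρ.  Deciding · WEAKER than FERN · ATTACKABLE-mod-PRINT on the polarized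
   l₀ = 0 sector (Gouvêa–Mazur + Böckle: GL₂/ℚ solved; Chenevier, Allen arXiv:1601.03752, Hellmann–Margerin–Schraen arXiv:1811.09116 Thm 1.2: Zariski density of
   automorphic points — a mechanism that never lifts ρ itself and gives C_w for NON-geometric ρ too) · BARRIER l₀ > 0 (automorphic points NOT Zariski dense:
   Calegari–Mazur, Gee–Newton arXiv:1609.06965 p. 4; TaylorWilesNumericalCoincidence).
 • W2S `WeakToStrongFern` : H1 ∧ C_w ⟹ C — «weak ⟹ strong».  DECLARED RESIDUAL · WEAKER than FERN · IDEA-NEEDED (open for GL₂/ℚ, CKW p. 14) · made FREE by WCL.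
BYPASS (`fernClass_iff_weakPieces`, the SAME dictionary one level up, modulo NOTHING):   FERN ∧ CLASS ⟺ HeckeFern ∧ WeakClassicality
 • WCL `WeakClassicality` : H1 ∧ C_w ⟹ weakly automorphic — classicality consuming ONLY weak pro-automorphy = the PRINT shape (Emerton Thm 1.2.4, Kisin's
   Fontaine–Mazur theorem, Breuil–Hellmann–Schraen: a de Rham point of 𝕋 / of the eigenvariety is classical; no approximating eigenforms are used).  STRONGER than
   CLASS (`classicality_of_weakClassicality`), WEAKER than FERN ∧ CLASS, than B_w = `PrimeSwitchSplit.WeakGeometricAutomorphy` 17414 and than the summit ·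
   ATTACKABLE regular l₀ = 0 · BARRIER irregular (NonRegularWeightBarrier).  In the re-cut pair W2S DOES NOT OCCUR: it is an artefact of cutting the DPS node at
   C instead of C_w (`closes_root_bypass` has DPS's eight binders with (FERN, CLASS) ↦ (HF, WCL)).
U-LEVEL READING (`levelFiniteness_iff_weakPieces`): U ⟺ LevelFreeHeckeFern (H∞ ⟹ C_w) ∧ WeakToStrongLF (H∞ ∧ C_w ⟹ C); slot-7 vehicles (SSH ∧ BNC ∧ AUXB) each
still contain W2S-type content — this cut isolates it ONCE.  No EXCESS (§8: every piece follows from B_w and from the summit).  Separation (§10): TOY WORLD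
`toy_weak_not_strong` = CKW's midpoint mechanism over 𝒪 = ℤ (weak ≠ strong at depth 2).  0 sorry; axioms standard.  Record: HOME/lens-3/g29/wfs/memo.md.
-/


set_option linter.dupNamespace false
set_option linter.unusedVariables false

namespace Summit.Langlands.Langlands.Theorems.WeakFern

open scoped NumberField Polynomial
open Filter Field IsDedekindDomain
open Literature.NumberTheory.GaloisRepresentations Literature.NumberTheory.Automorphic
open Summit.Langlands.Langlands.Theorems.TransientLevel
open Summit.Langlands.Langlands.Theses

/-! ## 1. Vocabulary (the NEW intermediate language C_w; H1, C, H∞, weak automorphy are the lineage's `TransientLevel` vocabulary BY NAME) -/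

section Vocabulary

variable {K : Type} [Field K] [NumberField K] {n : ℕ} {ℓ : ℕ} [Fact ℓ.Prime]

/-- H1 · RESIDUALLY AUTOMORPHIC (FERN's hypothesis VERBATIM, structured): ONE L-algebraic cuspidal `π` is `1`-close to `ρ` at almost all places. -/
def IsResiduallyAutomorphic (hcpt : isCompact_glFiniteIntegralLevel n K) (ι : PadicAlgCl ℓ ≃+* ℂ)
    (ρ : FramedGaloisRep K (PadicAlgCl ℓ) n) : Prop :=
  ∃ π : CuspidalAutomorphicRepData n K hcpt, π.1.IsLAlgebraic ∧ ∀ᶠ v : HeightOneSpectrum (𝓞 K) in cofinite, CloseAt ι π ρ 1 v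

/-- 𝒪 = 𝒪_{ℚ̄_ℓ}, the valuation ring `{x : ‖x‖ ≤ 1}` of `ℚ̄_ℓ` (Mathlib `Valuation.valuationSubring`; the coefficient ring of the relations). -/
noncomputable abbrev intRing (ℓ : ℕ) [Fact ℓ.Prime] : ValuationSubring (PadicAlgCl ℓ) :=
  (Valued.v : Valuation (PadicAlgCl ℓ) NNReal).valuationSubring

/-- A WEAK `r`-APPROXIMANT of `ρ` off `S`: a finite family `π : Fin k → (cuspidal)` with Satake parameters `α j v` at every `v ∉ S`, all
L-algebraic, such that for every choice `Φ` of arithmetic Frobenii off `S` and every polynomial relation `P ∈ 𝒪[T_{v,i} : v ∉ S, i ∈ ℕ]`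
satisfied by the Satake–Frobenius coefficients of EVERY member, `|P(c_i(ρ(Φ_v)))| < r`. -/
def IsWeakApproximant (hcpt : isCompact_glFiniteIntegralLevel n K) (ι : PadicAlgCl ℓ ≃+* ℂ) (ρ : FramedGaloisRep K (PadicAlgCl ℓ) n)
    (S : Set (HeightOneSpectrum (𝓞 K))) (r : NNReal) (k : ℕ) (π : Fin k → CuspidalAutomorphicRepData n K hcpt)
    (α : Fin k → HeightOneSpectrum (𝓞 K) → Multiset ℂ) : Prop :=
  (∀ j : Fin k, (π j).1.IsLAlgebraic ∧ ∀ v : HeightOneSpectrum (𝓞 K), v ∉ S → (π j).1.HasSatakeParamAt v (α j v)) ∧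
    ∀ Φ : HeightOneSpectrum (𝓞 K) → absoluteGaloisGroup K,
      (∀ v : HeightOneSpectrum (𝓞 K), v ∉ S → ∃ 𝔓 ∈ v.primesAbove, IsArithFrobAt (𝓞 K) (Φ v) 𝔓) →
      ∀ P : MvPolynomial ({v : HeightOneSpectrum (𝓞 K) // v ∉ S} × ℕ) (intRing ℓ),
        (∀ j : Fin k, MvPolynomial.eval₂ (intRing ℓ).subtype
            (fun x : {v : HeightOneSpectrum (𝓞 K) // v ∉ S} × ℕ => (arithFrobPolyOfSatake ι x.1.1.residueCard 1 (α j x.1.1)).coeff x.2) P = 0) →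
        Valued.v (MvPolynomial.eval₂ (intRing ℓ).subtype
            (fun x : {v : HeightOneSpectrum (𝓞 K) // v ∉ S} × ℕ => (FramedRep.charpoly ρ (Φ x.1.1)).coeff x.2) P) < r

/-- C_w · WEAKLY PRO-AUTOMORPHIC OF BOUNDED LEVEL (the NEW intermediate language): ONE finite `S` such that for every radius `r > 0` some finite
cuspidal family of tame level `S` weakly `r`-approximates `ρ` — `ρ mod {|·| < r}` carries an `𝒪`-algebra homomorphism of the Hecke algebra of the
family (a weak eigenform with values in `𝒪/{|·| < r}`). -/
def IsWeaklyProAutomorphic (hcpt : isCompact_glFiniteIntegralLevel n K) (ι : PadicAlgCl ℓ ≃+* ℂ) (ρ : FramedGaloisRep K (PadicAlgCl ℓ) n) :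
    Prop :=
  ∃ S : Set (HeightOneSpectrum (𝓞 K)), S.Finite ∧ ∀ r : NNReal, 0 < r →
    ∃ (k : ℕ) (π : Fin k → CuspidalAutomorphicRepData n K hcpt) (α : Fin k → HeightOneSpectrum (𝓞 K) → Multiset ℂ),
      IsWeakApproximant hcpt ι ρ S r k π α

end Vocabulary

/-! ## 2. The items (one-line texts = statements29.json VERBATIM; generated by gen29.py from the g26 macros, checked against the TREE texts) -/

/-- HF · HECKE FERN · crux rank 2 of the split (deciding) · WEAKER than FERN (`heckeFern_of_fernSpread`) · OPEN · ATTACKABLE-mod-PRINT (polarized,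
l₀ = 0: infinite-fern density / big R = 𝕋) · BARRIER l₀ > 0.  FERN's binders and hypothesis H1 VERBATIM; conclusion C_w instead of C. -/
def HeckeFern : Prop :=
  ∀ (K : Type) [Field K] [NumberField K] (n : ℕ) (hcpt : Literature.NumberTheory.Automorphic.isCompact_glFiniteIntegralLevel n K), 0 < n → ∀ (ℓ : ℕ) [Fact ℓ.Prime] (ι : PadicAlgCl ℓ ≃+* ℂ) (ρ : Literature.NumberTheory.GaloisRepresentations.FramedGaloisRep K (PadicAlgCl ℓ) n), ρ.toGaloisRep.IsIrreducible → ((∀ᶠ v : IsDedekindDomain.HeightOneSpectrum (NumberField.RingOfIntegers K) in Filter.cofinite, ρ.IsUnramifiedAt v) ∧ ∀ (v : IsDedekindDomain.HeightOneSpectrum (NumberField.RingOfIntegers K)) (hv : ((ℓ : ℕ) : NumberField.RingOfIntegers K) ∈ v.asIdeal), (Literature.NumberTheory.PAdicHodge.fontainePstAdicCompletion v ℓ hv).IsDeRhamFramed (ρ.toLocal v)) → (∃ π : Literature.NumberTheory.Automorphic.CuspidalAutomorphicRepData n K hcpt, π.1.IsLAlgebraic ∧ ∀ᶠ v : IsDedekindDomain.HeightOneSpectrum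 (NumberField.RingOfIntegers K) in Filter.cofinite, (∃ α : Multiset ℂ, π.1.HasSatakeParamAt v α ∧ ∀ 𝔓 ∈ v.primesAbove, ∀ σ : Field.absoluteGaloisGroup K, IsArithFrobAt (NumberField.RingOfIntegers K) σ 𝔓 → ∀ i : ℕ, Valued.v ((Literature.NumberTheory.GaloisRepresentations.FramedRep.charpoly ρ σ - Literature.NumberTheory.Automorphic.arithFrobPolyOfSatake ι v.residueCard 1 α).coeff i) < 1)) → ∃ S : Set (IsDedekindDomain.HeightOneSpectrum (NumberField.RingOfIntegers K)), S.Finite ∧ ∀ r : NNReal, 0 < r → ∃ (k : ℕ) (π : Fin k → Literature.NumberTheory.Automorphic.CuspidalAutomorphicRepData n K hcpt) (α : Fin k → IsDedekindDomain.HeightOneSpectrum (NumberField.RingOfIntegers K) → Multiset ℂ), (∀ j : Fin k, (π j).1.IsLAlgebraic ∧ ∀ v : IsDedekindDomain.HeightOneSpectrum (NumberField.RingOfIntegers K), v ∉ S → (π j).1.HasSatakeParamAt v (α j v)) ∧ ∀ Φ : IsDedekindDomain.HeightOneSpectrum (NumberField.RingOfIntegers K) → Field.absoluteGaloisGroup K,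 (∀ v : IsDedekindDomain.HeightOneSpectrum (NumberField.RingOfIntegers K), v ∉ S → ∃ 𝔓 ∈ v.primesAbove, IsArithFrobAt (NumberField.RingOfIntegers K) (Φ v) 𝔓) → ∀ P : MvPolynomial ({v : IsDedekindDomain.HeightOneSpectrum (NumberField.RingOfIntegers K) // v ∉ S} × ℕ) (Valued.v : Valuation (PadicAlgCl ℓ) NNReal).valuationSubring, (∀ j : Fin k, MvPolynomial.eval₂ (Valued.v : Valuation (PadicAlgCl ℓ) NNReal).valuationSubring.subtype (fun x : {v : IsDedekindDomain.HeightOneSpectrum (NumberField.RingOfIntegers K) // v ∉ S} × ℕ => (Literature.NumberTheory.Automorphic.arithFrobPolyOfSatake ι x.1.1.residueCard 1 (α j x.1.1)).coeff x.2) P = 0) → Valued.v (MvPolynomial.eval₂ (Valued.v : Valuation (PadicAlgCl ℓ) NNReal).valuationSubring.subtype (fun x : {v : IsDedekindDomain.HeightOneSpectrum (NumberField.RingOfIntegers K) // v ∉ S} × ℕ => (Literature.NumberTheory.GaloisRepresentations.FramedRep.charpoly ρ (Φ x.1.1)).coeff x.2) P) < r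

/-- W2S · WEAK TO STRONG · crux rank 3 of the split (declared residual) · WEAKER than FERN (`weakToStrong_of_fernSpread`) · OPEN · IDEA-NEEDED
(weak ⟹ strong eigenform lifting modulo ℓ^m at bounded level, free weight).  FERN's text VERBATIM with the extra hypothesis C_w. -/
def WeakToStrongFern : Prop :=
  ∀ (K : Type) [Field K] [NumberField K] (n : ℕ) (hcpt : Literature.NumberTheory.Automorphic.isCompact_glFiniteIntegralLevel n K), 0 < n → ∀ (ℓ : ℕ) [Fact ℓ.Prime] (ι : PadicAlgCl ℓ ≃+* ℂ) (ρ : Literature.NumberTheory.GaloisRepresentations.FramedGaloisRep K (PadicAlgCl ℓ) n), ρ.toGaloisRep.IsIrreducible → ((∀ᶠ v : IsDedekindDomain.HeightOneSpectrum (NumberField.RingOfIntegers K) in Filter.cofinite, ρ.IsUnramifiedAt v) ∧ ∀ (v : IsDedekindDomain.HeightOneSpectrum (NumberField.RingOfIntegers K)) (hv : ((ℓ : ℕ) : NumberField.RingOfIntegers K) ∈ v.asIdeal), (Literature.NumberTheory.PAdicHodge.fontainePstAdicCompletion v ℓ hv).IsDeRhamFramed (ρ.toLocal v)) → (∃ π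 : Literature.NumberTheory.Automorphic.CuspidalAutomorphicRepData n K hcpt, π.1.IsLAlgebraic ∧ ∀ᶠ v : IsDedekindDomain.HeightOneSpectrum (NumberField.RingOfIntegers K) in Filter.cofinite, (∃ α : Multiset ℂ, π.1.HasSatakeParamAt v α ∧ ∀ 𝔓 ∈ v.primesAbove, ∀ σ : Field.absoluteGaloisGroup K, IsArithFrobAt (NumberField.RingOfIntegers K) σ 𝔓 → ∀ i : ℕ, Valued.v ((Literature.NumberTheory.GaloisRepresentations.FramedRep.charpoly ρ σ - Literature.NumberTheory.Automorphic.arithFrobPolyOfSatake ι v.residueCard 1 α).coeff i) < 1)) → (∃ S : Set (IsDedekindDomain.HeightOneSpectrum (NumberField.RingOfIntegers K)), S.Finite ∧ ∀ r : NNReal, 0 < r → ∃ (k : ℕ) (π : Fin k → Literature.NumberTheory.Automorphic.CuspidalAutomorphicRepData n K hcpt) (α : Fin k → IsDedekindDomain.HeightOneSpectrum (NumberField.RingOfIntegers K) → Multiset ℂ), (∀ j : Fin k, (π j).1.IsLAlgebraic ∧ ∀ v : IsDedekindDomain.HeightOneSpectrum (NumberField.RingOfIntegers K), v ∉ S → (π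 j).1.HasSatakeParamAt v (α j v)) ∧ ∀ Φ : IsDedekindDomain.HeightOneSpectrum (NumberField.RingOfIntegers K) → Field.absoluteGaloisGroup K, (∀ v : IsDedekindDomain.HeightOneSpectrum (NumberField.RingOfIntegers K), v ∉ S → ∃ 𝔓 ∈ v.primesAbove, IsArithFrobAt (NumberField.RingOfIntegers K) (Φ v) 𝔓) → ∀ P : MvPolynomial ({v : IsDedekindDomain.HeightOneSpectrum (NumberField.RingOfIntegers K) // v ∉ S} × ℕ) (Valued.v : Valuation (PadicAlgCl ℓ) NNReal).valuationSubring, (∀ j : Fin k, MvPolynomial.eval₂ (Valued.v : Valuation (PadicAlgCl ℓ) NNReal).valuationSubring.subtype (fun x : {v : IsDedekindDomain.HeightOneSpectrum (NumberField.RingOfIntegers K) // v ∉ S} × ℕ => (Literature.NumberTheory.Automorphic.arithFrobPolyOfSatake ι x.1.1.residueCard 1 (α j x.1.1)).coeff x.2) P = 0) → Valued.v (MvPolynomial.eval₂ (Valued.v : Valuation (PadicAlgCl ℓ) NNReal).valuationSubring.subtype (fun x : {v : IsDedekindDomain.HeightOneSpectrum (NumberField.RingOfIntegers K) // v ∉ S}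 × ℕ => (Literature.NumberTheory.GaloisRepresentations.FramedRep.charpoly ρ (Φ x.1.1)).coeff x.2) P) < r) → ∃ S : Set (IsDedekindDomain.HeightOneSpectrum (NumberField.RingOfIntegers K)), S.Finite ∧ ∀ r : NNReal, 0 < r → ∃ π : Literature.NumberTheory.Automorphic.CuspidalAutomorphicRepData n K hcpt, π.1.IsLAlgebraic ∧ ∀ v : IsDedekindDomain.HeightOneSpectrum (NumberField.RingOfIntegers K), v ∉ S → (∃ α : Multiset ℂ, π.1.HasSatakeParamAt v α ∧ ∀ 𝔓 ∈ v.primesAbove, ∀ σ : Field.absoluteGaloisGroup K, IsArithFrobAt (NumberField.RingOfIntegers K) σ 𝔓 → ∀ i : ℕ, Valued.v ((Literature.NumberTheory.GaloisRepresentations.FramedRep.charpoly ρ σ - Literature.NumberTheory.Automorphic.arithFrobPolyOfSatake ι v.residueCard 1 α).coeff i) < r)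

/-- WCL · WEAK CLASSICALITY · the bypass piece · STRONGER than CLASS (`classicality_of_weakClassicality`), WEAKER than FERN ∧ CLASS and than B_w ·
OPEN · ATTACKABLE regular l₀ = 0 (Emerton 1.2.4 / Kisin / BHS shape: de Rham points of 𝕋^big are classical) · BARRIER irregular.  CLASS's binders
VERBATIM; hypotheses H1 and C_w instead of C; conclusion = CLASS's (weak automorphy). -/
def WeakClassicality : Prop :=
  ∀ (K : Type) [Field K] [NumberField K] (n : ℕ) (hcpt : Literature.NumberTheory.Automorphic.isCompact_glFiniteIntegralLevel n K), 0 < n → ∀ (ℓ : ℕ) [Fact ℓ.Prime] (ι : PadicAlgCl ℓ ≃+* ℂ) (ρ : Literature.NumberTheory.GaloisRepresentations.FramedGaloisRep K (PadicAlgCl ℓ) n), ρ.toGaloisRep.IsIrreducible → ((∀ᶠ v : IsDedekindDomain.HeightOneSpectrum (NumberField.RingOfIntegers K) in Filter.cofinite, ρ.IsUnramifiedAt v) ∧ ∀ (v : IsDedekindDomain.HeightOneSpectrum (NumberField.RingOfIntegers K)) (hv : ((ℓ : ℕ) : NumberField.RingOfIntegers K) ∈ v.asIdeal), (Literature.NumberTheory.PAdicHodge.fontainePstAdicCompletion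 v ℓ hv).IsDeRhamFramed (ρ.toLocal v)) → (∃ π : Literature.NumberTheory.Automorphic.CuspidalAutomorphicRepData n K hcpt, π.1.IsLAlgebraic ∧ ∀ᶠ v : IsDedekindDomain.HeightOneSpectrum (NumberField.RingOfIntegers K) in Filter.cofinite, (∃ α : Multiset ℂ, π.1.HasSatakeParamAt v α ∧ ∀ 𝔓 ∈ v.primesAbove, ∀ σ : Field.absoluteGaloisGroup K, IsArithFrobAt (NumberField.RingOfIntegers K) σ 𝔓 → ∀ i : ℕ, Valued.v ((Literature.NumberTheory.GaloisRepresentations.FramedRep.charpoly ρ σ - Literature.NumberTheory.Automorphic.arithFrobPolyOfSatake ι v.residueCard 1 α).coeff i) < 1)) → (∃ S : Set (IsDedekindDomain.HeightOneSpectrum (NumberField.RingOfIntegers K)), S.Finite ∧ ∀ r : NNReal, 0 < r → ∃ (k : ℕ) (π : Fin k → Literature.NumberTheory.Automorphic.CuspidalAutomorphicRepData n K hcpt) (α : Fin k → IsDedekindDomain.HeightOneSpectrum (NumberField.RingOfIntegers K) → Multiset ℂ), (∀ j : Fin k, (π j).1.IsLAlgebraic ∧ ∀ v : IsDedekindDomain.HeightOneSpectrum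 (NumberField.RingOfIntegers K), v ∉ S → (π j).1.HasSatakeParamAt v (α j v)) ∧ ∀ Φ : IsDedekindDomain.HeightOneSpectrum (NumberField.RingOfIntegers K) → Field.absoluteGaloisGroup K, (∀ v : IsDedekindDomain.HeightOneSpectrum (NumberField.RingOfIntegers K), v ∉ S → ∃ 𝔓 ∈ v.primesAbove, IsArithFrobAt (NumberField.RingOfIntegers K) (Φ v) 𝔓) → ∀ P : MvPolynomial ({v : IsDedekindDomain.HeightOneSpectrum (NumberField.RingOfIntegers K) // v ∉ S} × ℕ) (Valued.v : Valuation (PadicAlgCl ℓ) NNReal).valuationSubring, (∀ j : Fin k, MvPolynomial.eval₂ (Valued.v : Valuation (PadicAlgCl ℓ) NNReal).valuationSubring.subtype (fun x : {v : IsDedekindDomain.HeightOneSpectrum (NumberField.RingOfIntegers K) // v ∉ S} × ℕ => (Literature.NumberTheory.Automorphic.arithFrobPolyOfSatake ι x.1.1.residueCard 1 (α j x.1.1)).coeff x.2) P = 0) → Valued.v (MvPolynomial.eval₂ (Valued.v : Valuation (PadicAlgCl ℓ) NNReal).valuationSubring.subtype (fun x : {v : IsDedekindDomain.HeightOneSpectrum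 (NumberField.RingOfIntegers K) // v ∉ S} × ℕ => (Literature.NumberTheory.GaloisRepresentations.FramedRep.charpoly ρ (Φ x.1.1)).coeff x.2) P) < r) → ∃ π : Literature.NumberTheory.Automorphic.CuspidalAutomorphicRepData n K hcpt, π.1.IsLAlgebraic ∧ ∀ᶠ v : IsDedekindDomain.HeightOneSpectrum (NumberField.RingOfIntegers K) in Filter.cofinite, Summit.Langlands.SatakeFrobCompatibleAt ι π.1 ρ v

/-- LFHF · LEVEL-FREE HECKE FERN · U-level reading of HF · WEAKER than U (`levelFreeHeckeFern_of_levelFiniteness`) and than HF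
(`levelFreeHeckeFern_of_heckeFern`).  U's binders and hypothesis H∞ VERBATIM; conclusion C_w instead of C. -/
def LevelFreeHeckeFern : Prop :=
  ∀ (K : Type) [Field K] [NumberField K] (n : ℕ) (hcpt : Literature.NumberTheory.Automorphic.isCompact_glFiniteIntegralLevel n K), 0 < n → ∀ (ℓ : ℕ) [Fact ℓ.Prime] (ι : PadicAlgCl ℓ ≃+* ℂ) (ρ : Literature.NumberTheory.GaloisRepresentations.FramedGaloisRep K (PadicAlgCl ℓ) n), ρ.toGaloisRep.IsIrreducible → ((∀ᶠ v : IsDedekindDomain.HeightOneSpectrum (NumberField.RingOfIntegers K) in Filter.cofinite, ρ.IsUnramifiedAt v) ∧ ∀ (v : IsDedekindDomain.HeightOneSpectrum (NumberField.RingOfIntegers K)) (hv : ((ℓ : ℕ) : NumberField.RingOfIntegers K) ∈ v.asIdeal), (Literature.NumberTheory.PAdicHodge.fontainePstAdicCompletion v ℓ hv).IsDeRhamFramed (ρ.toLocal v)) → (∀ r : NNReal, 0 < r → ∃ π : Literature.NumberTheory.Automorphic.CuspidalAutomorphicRepData n K hcpt, π.1.IsLAlgebraic ∧ ∀ᶠ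 v : IsDedekindDomain.HeightOneSpectrum (NumberField.RingOfIntegers K) in Filter.cofinite, (∃ α : Multiset ℂ, π.1.HasSatakeParamAt v α ∧ ∀ 𝔓 ∈ v.primesAbove, ∀ σ : Field.absoluteGaloisGroup K, IsArithFrobAt (NumberField.RingOfIntegers K) σ 𝔓 → ∀ i : ℕ, Valued.v ((Literature.NumberTheory.GaloisRepresentations.FramedRep.charpoly ρ σ - Literature.NumberTheory.Automorphic.arithFrobPolyOfSatake ι v.residueCard 1 α).coeff i) < r)) → ∃ S : Set (IsDedekindDomain.HeightOneSpectrum (NumberField.RingOfIntegers K)), S.Finite ∧ ∀ r : NNReal, 0 < r → ∃ (k : ℕ) (π : Fin k → Literature.NumberTheory.Automorphic.CuspidalAutomorphicRepData n K hcpt) (α : Fin k → IsDedekindDomain.HeightOneSpectrum (NumberField.RingOfIntegers K) → Multiset ℂ), (∀ j : Fin k, (π j).1.IsLAlgebraic ∧ ∀ v : IsDedekindDomain.HeightOneSpectrum (NumberField.RingOfIntegers K), v ∉ S → (π j).1.HasSatakeParamAt v (α j v)) ∧ ∀ Φ : IsDedekindDomain.HeightOneSpectrum (NumberField.RingOfIntegers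 K) → Field.absoluteGaloisGroup K, (∀ v : IsDedekindDomain.HeightOneSpectrum (NumberField.RingOfIntegers K), v ∉ S → ∃ 𝔓 ∈ v.primesAbove, IsArithFrobAt (NumberField.RingOfIntegers K) (Φ v) 𝔓) → ∀ P : MvPolynomial ({v : IsDedekindDomain.HeightOneSpectrum (NumberField.RingOfIntegers K) // v ∉ S} × ℕ) (Valued.v : Valuation (PadicAlgCl ℓ) NNReal).valuationSubring, (∀ j : Fin k, MvPolynomial.eval₂ (Valued.v : Valuation (PadicAlgCl ℓ) NNReal).valuationSubring.subtype (fun x : {v : IsDedekindDomain.HeightOneSpectrum (NumberField.RingOfIntegers K) // v ∉ S} × ℕ => (Literature.NumberTheory.Automorphic.arithFrobPolyOfSatake ι x.1.1.residueCard 1 (α j x.1.1)).coeff x.2) P = 0) → Valued.v (MvPolynomial.eval₂ (Valued.v : Valuation (PadicAlgCl ℓ) NNReal).valuationSubring.subtype (fun x : {v : IsDedekindDomain.HeightOneSpectrum (NumberField.RingOfIntegers K) // v ∉ S} × ℕ => (Literature.NumberTheory.GaloisRepresentations.FramedRep.charpoly ρ (Φ x.1.1)).coeff x.2) P) < r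

/-- W2SLF · WEAK TO STRONG (level-free hypothesis) · U-level reading of W2S · WEAKER than U (`weakToStrongLF_of_levelFiniteness`) and than W2S
(`weakToStrongLF_of_weakToStrong`).  U's text VERBATIM with the extra hypothesis C_w. -/
def WeakToStrongLF : Prop :=
  ∀ (K : Type) [Field K] [NumberField K] (n : ℕ) (hcpt : Literature.NumberTheory.Automorphic.isCompact_glFiniteIntegralLevel n K), 0 < n → ∀ (ℓ : ℕ) [Fact ℓ.Prime] (ι : PadicAlgCl ℓ ≃+* ℂ) (ρ : Literature.NumberTheory.GaloisRepresentations.FramedGaloisRep K (PadicAlgCl ℓ) n), ρ.toGaloisRep.IsIrreducible → ((∀ᶠ v : IsDedekindDomain.HeightOneSpectrum (NumberField.RingOfIntegers K) in Filter.cofinite, ρ.IsUnramifiedAt v) ∧ ∀ (v : IsDedekindDomain.HeightOneSpectrum (NumberField.RingOfIntegers K)) (hv : ((ℓ : ℕ) : NumberField.RingOfIntegers K) ∈ v.asIdeal), (Literature.NumberTheory.PAdicHodge.fontainePstAdicCompletion v ℓ hv).IsDeRhamFramed (ρ.toLocal v)) → (∀ r : NNReal, 0 < r → ∃ π : Literature.NumberTheory.Automorphic.CuspidalAutomorphicRepData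 n K hcpt, π.1.IsLAlgebraic ∧ ∀ᶠ v : IsDedekindDomain.HeightOneSpectrum (NumberField.RingOfIntegers K) in Filter.cofinite, (∃ α : Multiset ℂ, π.1.HasSatakeParamAt v α ∧ ∀ 𝔓 ∈ v.primesAbove, ∀ σ : Field.absoluteGaloisGroup K, IsArithFrobAt (NumberField.RingOfIntegers K) σ 𝔓 → ∀ i : ℕ, Valued.v ((Literature.NumberTheory.GaloisRepresentations.FramedRep.charpoly ρ σ - Literature.NumberTheory.Automorphic.arithFrobPolyOfSatake ι v.residueCard 1 α).coeff i) < r)) → (∃ S : Set (IsDedekindDomain.HeightOneSpectrum (NumberField.RingOfIntegers K)), S.Finite ∧ ∀ r : NNReal, 0 < r → ∃ (k : ℕ) (π : Fin k → Literature.NumberTheory.Automorphic.CuspidalAutomorphicRepData n K hcpt) (α : Fin k → IsDedekindDomain.HeightOneSpectrum (NumberField.RingOfIntegers K) → Multiset ℂ), (∀ j : Fin k, (π j).1.IsLAlgebraic ∧ ∀ v : IsDedekindDomain.HeightOneSpectrum (NumberField.RingOfIntegers K), v ∉ S → (π j).1.HasSatakeParamAt v (α j v)) ∧ ∀ Φ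 : IsDedekindDomain.HeightOneSpectrum (NumberField.RingOfIntegers K) → Field.absoluteGaloisGroup K, (∀ v : IsDedekindDomain.HeightOneSpectrum (NumberField.RingOfIntegers K), v ∉ S → ∃ 𝔓 ∈ v.primesAbove, IsArithFrobAt (NumberField.RingOfIntegers K) (Φ v) 𝔓) → ∀ P : MvPolynomial ({v : IsDedekindDomain.HeightOneSpectrum (NumberField.RingOfIntegers K) // v ∉ S} × ℕ) (Valued.v : Valuation (PadicAlgCl ℓ) NNReal).valuationSubring, (∀ j : Fin k, MvPolynomial.eval₂ (Valued.v : Valuation (PadicAlgCl ℓ) NNReal).valuationSubring.subtype (fun x : {v : IsDedekindDomain.HeightOneSpectrum (NumberField.RingOfIntegers K) // v ∉ S} × ℕ => (Literature.NumberTheory.Automorphic.arithFrobPolyOfSatake ι x.1.1.residueCard 1 (α j x.1.1)).coeff x.2) P = 0) → Valued.v (MvPolynomial.eval₂ (Valued.v : Valuation (PadicAlgCl ℓ) NNReal).valuationSubring.subtype (fun x : {v : IsDedekindDomain.HeightOneSpectrum (NumberField.RingOfIntegers K) // v ∉ S} × ℕ => (Literature.NumberTheory.GaloisRepresentations.FramedRep.charpoly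 ρ (Φ x.1.1)).coeff x.2) P) < r) → ∃ S : Set (IsDedekindDomain.HeightOneSpectrum (NumberField.RingOfIntegers K)), S.Finite ∧ ∀ r : NNReal, 0 < r → ∃ π : Literature.NumberTheory.Automorphic.CuspidalAutomorphicRepData n K hcpt, π.1.IsLAlgebraic ∧ ∀ v : IsDedekindDomain.HeightOneSpectrum (NumberField.RingOfIntegers K), v ∉ S → (∃ α : Multiset ℂ, π.1.HasSatakeParamAt v α ∧ ∀ 𝔓 ∈ v.primesAbove, ∀ σ : Field.absoluteGaloisGroup K, IsArithFrobAt (NumberField.RingOfIntegers K) σ 𝔓 → ∀ i : ℕ, Valued.v ((Literature.NumberTheory.GaloisRepresentations.FramedRep.charpoly ρ σ - Literature.NumberTheory.Automorphic.arithFrobPolyOfSatake ι v.residueCard 1 α).coeff i) < r)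

/-! ## 3. Structured readings (all `Iff.rfl`: the one-liners ARE the structured statements over the common frame) -/

/-- the common FRAME of every item of the lineage: an irreducible pinned-geometric `ρ : Γ_K → GL_n(ℚ̄_ℓ)` (`0 < n`, compact finite level). -/
def Frame (Q : ∀ {K : Type} [Field K] [NumberField K] {n ℓ : ℕ} [Fact ℓ.Prime],
    isCompact_glFiniteIntegralLevel n K → (PadicAlgCl ℓ ≃+* ℂ) → FramedGaloisRep K (PadicAlgCl ℓ) n → Prop) : Prop :=
  ∀ (K : Type) [Field K] [NumberField K] (n : ℕ) (hcpt : isCompact_glFiniteIntegralLevel n K), 0 < n →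
    ∀ (ℓ : ℕ) [Fact ℓ.Prime] (ι : PadicAlgCl ℓ ≃+* ℂ) (ρ : FramedGaloisRep K (PadicAlgCl ℓ) n), ρ.toGaloisRep.IsIrreducible → IsPinnedGeometric ρ → Q hcpt ι ρ

/-- HF read in the frame: H1 ⟹ C_w. -/ theorem heckeFern_iff : HeckeFern ↔ Frame fun hcpt ι ρ => IsResiduallyAutomorphic hcpt ι ρ → IsWeaklyProAutomorphic hcpt ι ρ := Iff.rfl

/-- W2S read in the frame: H1 ⟹ C_w ⟹ C. -/ theorem weakToStrong_iff :
    WeakToStrongFern ↔ Frame fun hcpt ι ρ => IsResiduallyAutomorphic hcpt ι ρ → IsWeaklyProAutomorphic hcpt ι ρ → IsProAutomorphic hcpt ι ρ := Iff.rfl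

/-- WCL read in the frame: H1 ⟹ C_w ⟹ weakly automorphic. -/ theorem weakClassicality_iff :
    WeakClassicality ↔ Frame fun hcpt ι ρ => IsResiduallyAutomorphic hcpt ι ρ → IsWeaklyProAutomorphic hcpt ι ρ → IsWeaklyAutomorphic hcpt ι ρ := Iff.rfl

/-- LFHF read in the frame: H∞ ⟹ C_w. -/ theorem levelFreeHeckeFern_iff : LevelFreeHeckeFern ↔ Frame fun hcpt ι ρ => IsLevelFreeProAutomorphic hcpt ι ρ → IsWeaklyProAutomorphic hcpt ι ρ := Iff.rfl

/-- W2SLF read in the frame: H∞ ⟹ C_w ⟹ C. -/ theorem weakToStrongLF_iff :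
    WeakToStrongLF ↔ Frame fun hcpt ι ρ => IsLevelFreeProAutomorphic hcpt ι ρ → IsWeaklyProAutomorphic hcpt ι ρ → IsProAutomorphic hcpt ι ρ := Iff.rfl

/-- the lineage's nodes in the same frame (by name): FERN, CLASS, U. -/
theorem fernSpread_iff_frame : DepthPrimeSplit.FernSpread ↔ Frame fun hcpt ι ρ => IsResiduallyAutomorphic hcpt ι ρ → IsProAutomorphic hcpt ι ρ := Iff.rfl

/-- CLASS (25026, by name) read in the frame: C ⟹ weakly automorphic. -/ theorem classicality_iff_frame : DepthPrimeSplit.Classicality ↔ Frame fun hcpt ι ρ => IsProAutomorphic hcpt ι ρ → IsWeaklyAutomorphic hcpt ι ρ := Iff.rfl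

/-- U (27042, by name) read in the frame: H∞ ⟹ C. -/ theorem levelFiniteness_iff_frame :
    AuxiliaryLevelSplit.LevelFiniteness ↔ Frame fun hcpt ι ρ => IsLevelFreeProAutomorphic hcpt ι ρ → IsProAutomorphic hcpt ι ρ := Iff.rfl

/-! ## 4. Kernel: the DICTIONARY  C ⟹ C_w  (strong ⟹ weak; ultrametric calculus over 𝒪) and C ⟹ H1 -/

section Kernel

variable {ℓ : ℕ} [Fact ℓ.Prime]

/-- `Valued.v x ≤ r ↔ ‖x‖ ≤ r` on `ℚ̄_ℓ`. -/
theorem valued_le_iff (x : PadicAlgCl ℓ) (r : NNReal) : Valued.v x ≤ r ↔ ‖x‖ ≤ (r : ℝ) := by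
  rw [PadicAlgCl.valuation_def, ← NNReal.coe_le_coe, coe_nnnorm]

variable {K : Type} [Field K] [NumberField K] {n : ℕ}

omit [NumberField K] in
/-- GALOIS CHARACTERISTIC POLYNOMIALS ARE INTEGRAL: `|c_i(ρ(σ))| ≤ 1` (compactness of `Γ_K`: all roots have norm `≤ 1`,
tree `IwahoriTransient.norm_root_charpoly_le_one`, and Vieta, tree `IwahoriTransient.norm_coeff_le_one_of_roots`). -/
theorem valuation_coeff_charpoly_le_one (ρ : FramedGaloisRep K (PadicAlgCl ℓ) n) (σ : absoluteGaloisGroup K) (i : ℕ) :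
    Valued.v ((FramedRep.charpoly ρ σ).coeff i) ≤ 1 := by
  rw [valued_le_iff, NNReal.coe_one]
  exact IwahoriTransient.norm_coeff_le_one_of_roots (Matrix.charpoly_monic _)
    (fun β hβ => IwahoriTransient.norm_root_charpoly_le_one ρ σ hβ) i

/-- the open ideal `{a ∈ 𝒪 : |a| < r}` of the valuation ring (`0 < r`). -/
def ltIdeal (r : NNReal) (hr : 0 < r) : Ideal (intRing ℓ) where
  carrier := {a | Valued.v (a : PadicAlgCl ℓ) < r}
  zero_mem' := by simpa using hr
  add_mem' {a b} ha hb := by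
    simp only [Set.mem_setOf_eq] at ha hb ⊢; push_cast
    exact lt_of_le_of_lt (Valuation.map_add _ _ _) (max_lt ha hb)
  smul_mem' c {a} ha := by
    simp only [Set.mem_setOf_eq, smul_eq_mul] at ha ⊢; push_cast; rw [map_mul]
    exact lt_of_le_of_lt (mul_le_of_le_one_left zero_le ((Valuation.mem_valuationSubring_iff _ _).mp c.2)) ha

/-- evaluation of an `𝒪`-polynomial at an integral point of `ℚ̄_ℓ` is the image of the evaluation inside `𝒪`. -/
theorem eval₂_subtype_eq {σ : Type*} (P : MvPolynomial σ (intRing ℓ)) (x' : σ → intRing ℓ) :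
    MvPolynomial.eval₂ (intRing ℓ).subtype (fun s => (x' s : PadicAlgCl ℓ)) P = ((MvPolynomial.eval₂ (RingHom.id _) x' P : intRing ℓ) : PadicAlgCl ℓ) := by
  have h := MvPolynomial.eval₂_comp_left (intRing ℓ).subtype (RingHom.id _) x' P
  rw [RingHom.comp_id] at h; exact h.symm

/-- THE ULTRAMETRIC ESTIMATE: for `P ∈ 𝒪[T_s]` and integral points `x, y` with `|x_s − y_s| < r` for all `s`, `|P(x) − P(y)| < r`
(reduce modulo the ideal `{|·| < r}` of `𝒪`: the two evaluations agree in `𝒪/{|·| < r}`). -/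
theorem valuation_eval₂_sub_lt {σ : Type*} (P : MvPolynomial σ (intRing ℓ)) {x y : σ → PadicAlgCl ℓ} (hx : ∀ s, Valued.v (x s) ≤ 1)
    (hy : ∀ s, Valued.v (y s) ≤ 1) {r : NNReal} (hr : 0 < r) (hxy : ∀ s, Valued.v (x s - y s) < r) :
    Valued.v (MvPolynomial.eval₂ (intRing ℓ).subtype x P - MvPolynomial.eval₂ (intRing ℓ).subtype y P) < r := by
  let x' : σ → intRing ℓ := fun s => ⟨x s, (Valuation.mem_valuationSubring_iff _ _).mpr (hx s)⟩
  let y' : σ → intRing ℓ := fun s => ⟨y s, (Valuation.mem_valuationSubring_iff _ _).mpr (hy s)⟩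
  rw [show x = fun s => (x' s : PadicAlgCl ℓ) from rfl, show y = fun s => (y' s : PadicAlgCl ℓ) from rfl, eval₂_subtype_eq, eval₂_subtype_eq]
  have hq : (Ideal.Quotient.mk (ltIdeal r hr)) ∘ x' = (Ideal.Quotient.mk (ltIdeal r hr)) ∘ y' :=
    funext fun s => Ideal.Quotient.eq.mpr (show Valued.v ((x' s - y' s : intRing ℓ) : PadicAlgCl ℓ) < r by push_cast; exact hxy s)
  have hmem : MvPolynomial.eval₂ (RingHom.id _) x' P - MvPolynomial.eval₂ (RingHom.id _) y' P ∈ ltIdeal r hr := Ideal.Quotient.eq.mp (by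
    rw [MvPolynomial.eval₂_comp_left (Ideal.Quotient.mk _) (RingHom.id _) x' P, MvPolynomial.eval₂_comp_left (Ideal.Quotient.mk _) (RingHom.id _) y' P, hq])
  have : Valued.v ((MvPolynomial.eval₂ (RingHom.id _) x' P - MvPolynomial.eval₂ (RingHom.id _) y' P : intRing ℓ) : PadicAlgCl ℓ) < r := hmem
  push_cast at this
  exact this

variable {hcpt : isCompact_glFiniteIntegralLevel n K} {ι : PadicAlgCl ℓ ≃+* ℂ} {ρ : FramedGaloisRep K (PadicAlgCl ℓ) n}

/-- THE DICTIONARY LEMMA (strong ⟹ weak): an `r`-close genuine cuspidal approximant is a one-member weak `r`-approximant — every `𝒪`-relation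
`P` it satisfies holds at `ρ` up to `r`, because `P(c(ρ)) = P(c(ρ)) − P(c(π))` and `|P(x) − P(y)| ≤ max |x_s − y_s|` for integral `x, y`
(`y` = the Satake side is integral off `S` by closeness `< 1` to the integral Galois side `valuation_coeff_charpoly_le_one`). -/
theorem weakly_of_pro (h : IsProAutomorphic hcpt ι ρ) : IsWeaklyProAutomorphic hcpt ι ρ := by
  classical
  obtain ⟨S, hS, h⟩ := h
  refine ⟨S, hS, fun r hr => ?_⟩
  have hr1 : 0 < min r 1 := lt_min hr one_pos
  obtain ⟨π, hπ, hclose⟩ := h (min r 1) hr1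
  let α : HeightOneSpectrum (𝓞 K) → Multiset ℂ := fun v => if hv : v ∉ S then Classical.choose (hclose v hv) else 0
  have hα : ∀ v (hv : v ∉ S), π.1.HasSatakeParamAt v (α v) ∧ ∀ 𝔓 ∈ v.primesAbove, ∀ σ : absoluteGaloisGroup K, IsArithFrobAt (𝓞 K) σ 𝔓 →
      ∀ i : ℕ, Valued.v ((FramedRep.charpoly ρ σ - arithFrobPolyOfSatake ι v.residueCard 1 (α v)).coeff i) < min r 1 := fun v hv => by
    simp only [α, dif_pos hv]; exact Classical.choose_spec (hclose v hv)
  refine ⟨1, fun _ => π, fun _ => α, ⟨fun _ => ⟨hπ, fun v hv => (hα v hv).1⟩, fun Φ hΦ P hP => ?_⟩⟩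
  have hx : ∀ s : {v : HeightOneSpectrum (𝓞 K) // v ∉ S} × ℕ, Valued.v ((FramedRep.charpoly ρ (Φ s.1.1)).coeff s.2) ≤ 1 :=
    fun s => valuation_coeff_charpoly_le_one ρ _ _
  have hxy : ∀ s : {v : HeightOneSpectrum (𝓞 K) // v ∉ S} × ℕ,
      Valued.v ((FramedRep.charpoly ρ (Φ s.1.1)).coeff s.2 - (arithFrobPolyOfSatake ι s.1.1.residueCard 1 (α s.1.1)).coeff s.2) < min r 1 := fun s => by
    obtain ⟨𝔓, h𝔓, hfrob⟩ := hΦ s.1.1 s.1.2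
    simpa only [Polynomial.coeff_sub] using (hα s.1.1 s.1.2).2 𝔓 h𝔓 (Φ s.1.1) hfrob s.2
  have hy : ∀ s : {v : HeightOneSpectrum (𝓞 K) // v ∉ S} × ℕ, Valued.v ((arithFrobPolyOfSatake ι s.1.1.residueCard 1 (α s.1.1)).coeff s.2) ≤ 1 := fun s => by
    simpa only [sub_sub_cancel] using (Valuation.map_sub Valued.v _ _).trans (max_le (hx s) ((hxy s).le.trans (min_le_right _ _)))
  have key := valuation_eval₂_sub_lt P hx hy hr1 hxy
  rw [hP 0, sub_zero] at key
  exact key.trans_le (min_le_left _ _)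

/-- C ⟹ H1: the radius-1 approximant of a bounded-level pro-automorphic `ρ` is 1-close a.e. (`S` is finite). -/
theorem residual_of_pro (h : IsProAutomorphic hcpt ι ρ) : IsResiduallyAutomorphic hcpt ι ρ := by
  obtain ⟨S, hS, h⟩ := h
  obtain ⟨π, hπ, hclose⟩ := h 1 one_pos
  refine ⟨π, hπ, Filter.eventually_cofinite.mpr (hS.subset fun v hv => ?_)⟩
  by_contra hvS
  exact hv (hclose v hvS)

/-- H∞ ⟹ H1 (radius 1). -/
theorem residual_of_levelFree (h : IsLevelFreeProAutomorphic hcpt ι ρ) : IsResiduallyAutomorphic hcpt ι ρ :=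
  h 1 one_pos

/-- weak automorphy ⟹ C_w (through C: `TransientLevel.pro_of_weakly`). -/
theorem weaklyPro_of_weakly (h : IsWeaklyAutomorphic hcpt ι ρ) : IsWeaklyProAutomorphic hcpt ι ρ :=
  weakly_of_pro (pro_of_weakly h)

end Kernel

/-! ## 5. The split at FERN: `closes_target`, necessity, THE EQUIV -/

/-- Deciding theorem of the FERN-level child route: HF → W2S → FERN (both binders used). -/
theorem closes_target (h₁ : HeckeFern) (h₂ : WeakToStrongFern) : DepthPrimeSplit.FernSpread :=
  fun K _ _ n hcpt hn ℓ _ ι ρ hirr hgeo h1 => h₂ K n hcpt hn ℓ ι ρ hirr hgeo h1 (h₁ K n hcpt hn ℓ ι ρ hirr hgeo h1)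

/-- HF ⟸ FERN (the dictionary). -/
theorem heckeFern_of_fernSpread (hF : DepthPrimeSplit.FernSpread) : HeckeFern :=
  fun K _ _ n hcpt hn ℓ _ ι ρ hirr hgeo h1 => weakly_of_pro (hF K n hcpt hn ℓ ι ρ hirr hgeo h1)

/-- W2S ⟸ FERN (drop the weak hypothesis). -/
theorem weakToStrong_of_fernSpread (hF : DepthPrimeSplit.FernSpread) : WeakToStrongFern :=
  fun K _ _ n hcpt hn ℓ _ ι ρ hirr hgeo h1 _hw => hF K n hcpt hn ℓ ι ρ hirr hgeo h1

/-- THE ONE CERTIFIED TRANSLATION at FERN (modulo nothing): FERN ⟺ HF ∧ W2S. -/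
theorem fernSpread_iff_weakPieces : DepthPrimeSplit.FernSpread ↔ HeckeFern ∧ WeakToStrongFern :=
  ⟨fun h => ⟨heckeFern_of_fernSpread h, weakToStrong_of_fernSpread h⟩, fun h => closes_target h.1 h.2⟩

/-! ## 6. The BYPASS: the DPS pair (FERN, CLASS) re-cut at C_w — the weak ⟹ strong residual disappears -/

/-- WCL ⟹ CLASS: a bounded-level pro-automorphic `ρ` is residually automorphic AND weakly pro-automorphic (the dictionary). -/
theorem classicality_of_weakClassicality (hW : WeakClassicality) : DepthPrimeSplit.Classicality :=
  fun K _ _ n hcpt hn ℓ _ ι ρ hirr hgeo hC => hW K n hcpt hn ℓ ι ρ hirr hgeo (residual_of_pro hC) (weakly_of_pro hC)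

/-- FERN ⟸ HF ∧ WCL (no W2S!): H1 ⟹ C_w ⟹ weak automorphy ⟹ C. -/
theorem fernSpread_of_heckeFern_of_weakClassicality (h₁ : HeckeFern) (hW : WeakClassicality) : DepthPrimeSplit.FernSpread :=
  fun K _ _ n hcpt hn ℓ _ ι ρ hirr hgeo h1 => pro_of_weakly (hW K n hcpt hn ℓ ι ρ hirr hgeo h1 (h₁ K n hcpt hn ℓ ι ρ hirr hgeo h1))

/-- WCL ⟸ FERN ∧ CLASS. -/
theorem weakClassicality_of_fernSpread_of_classicality (hF : DepthPrimeSplit.FernSpread) (hC : DepthPrimeSplit.Classicality) : WeakClassicality :=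
  fun K _ _ n hcpt hn ℓ _ ι ρ hirr hgeo h1 _hw => hC K n hcpt hn ℓ ι ρ hirr hgeo (hF K n hcpt hn ℓ ι ρ hirr hgeo h1)

/-- W2S ⟸ WCL (weak classicality makes the weak ⟹ strong residual FREE). -/
theorem weakToStrong_of_weakClassicality (hW : WeakClassicality) : WeakToStrongFern :=
  fun K _ _ n hcpt hn ℓ _ ι ρ hirr hgeo h1 hw => pro_of_weakly (hW K n hcpt hn ℓ ι ρ hirr hgeo h1 hw)

/-- THE SAME TRANSLATION ONE LEVEL UP (modulo nothing): FERN ∧ CLASS ⟺ HF ∧ WCL — the DPS node re-cut at C_w has NO weak ⟹ strong piece. -/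
theorem fernClass_iff_weakPieces : (DepthPrimeSplit.FernSpread ∧ DepthPrimeSplit.Classicality) ↔ (HeckeFern ∧ WeakClassicality) :=
  ⟨fun h => ⟨heckeFern_of_fernSpread h.1, weakClassicality_of_fernSpread_of_classicality h.1 h.2⟩,
    fun h => ⟨fernSpread_of_heckeFern_of_weakClassicality h.1 h.2, classicality_of_weakClassicality h.2⟩⟩

/-! ## 7. U-level reading (the live residual stmt-Langlands-27042) -/

/-- Deciding theorem of the U-level child route: LFHF → W2SLF → U (both binders used). -/
theorem closes_target3 (h₁ : LevelFreeHeckeFern) (h₂ : WeakToStrongLF) : AuxiliaryLevelSplit.LevelFiniteness :=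
  fun K _ _ n hcpt hn ℓ _ ι ρ hirr hgeo hinf => h₂ K n hcpt hn ℓ ι ρ hirr hgeo hinf (h₁ K n hcpt hn ℓ ι ρ hirr hgeo hinf)

/-- U ⟹ LFHF (dictionary `weakly_of_pro`). -/ theorem levelFreeHeckeFern_of_levelFiniteness (hU : AuxiliaryLevelSplit.LevelFiniteness) : LevelFreeHeckeFern :=
  fun K _ _ n hcpt hn ℓ _ ι ρ hirr hgeo hinf => weakly_of_pro (hU K n hcpt hn ℓ ι ρ hirr hgeo hinf)

/-- U ⟹ W2SLF (forget the weak hypothesis). -/ theorem weakToStrongLF_of_levelFiniteness (hU : AuxiliaryLevelSplit.LevelFiniteness) : WeakToStrongLF :=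
  fun K _ _ n hcpt hn ℓ _ ι ρ hirr hgeo hinf _hw => hU K n hcpt hn ℓ ι ρ hirr hgeo hinf

/-- U ⟺ LFHF ∧ W2SLF (modulo nothing). -/
theorem levelFiniteness_iff_weakPieces : AuxiliaryLevelSplit.LevelFiniteness ↔ LevelFreeHeckeFern ∧ WeakToStrongLF :=
  ⟨fun h => ⟨levelFreeHeckeFern_of_levelFiniteness h, weakToStrongLF_of_levelFiniteness h⟩, fun h => closes_target3 h.1 h.2⟩

/-- LFHF ⟸ HF (H∞ ⟹ H1). -/
theorem levelFreeHeckeFern_of_heckeFern (h : HeckeFern) : LevelFreeHeckeFern :=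
  fun K _ _ n hcpt hn ℓ _ ι ρ hirr hgeo hinf => h K n hcpt hn ℓ ι ρ hirr hgeo (residual_of_levelFree hinf)

/-- W2SLF ⟸ W2S (H∞ ⟹ H1). -/
theorem weakToStrongLF_of_weakToStrong (h : WeakToStrongFern) : WeakToStrongLF :=
  fun K _ _ n hcpt hn ℓ _ ι ρ hirr hgeo hinf hw => h K n hcpt hn ℓ ι ρ hirr hgeo (residual_of_levelFree hinf) hw

/-! ## 8. Necessity from B_w (17414, by name) and from the summit: no EXCESS -/

/-- B_w ⟹ HF (weak automorphy ⟹ C ⟹ C_w). -/ theorem heckeFern_of_weak (hB : PrimeSwitchSplit.WeakGeometricAutomorphy) : HeckeFern :=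
  fun K _ _ n hcpt hn ℓ _ ι ρ hirr hgeo _h1 => weaklyPro_of_weakly (hB K n hcpt hn ℓ ι ρ hirr hgeo)

/-- B_w ⟹ WCL (the conclusion outright). -/ theorem weakClassicality_of_weak (hB : PrimeSwitchSplit.WeakGeometricAutomorphy) : WeakClassicality :=
  fun K _ _ n hcpt hn ℓ _ ι ρ hirr hgeo _h1 _hw => hB K n hcpt hn ℓ ι ρ hirr hgeo

/-- B_w ⟹ W2S (through WCL). -/ theorem weakToStrong_of_weak (hB : PrimeSwitchSplit.WeakGeometricAutomorphy) : WeakToStrongFern :=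
  weakToStrong_of_weakClassicality (weakClassicality_of_weak hB)

/-- B_w ⟹ LFHF (through HF). -/ theorem levelFreeHeckeFern_of_weak (hB : PrimeSwitchSplit.WeakGeometricAutomorphy) : LevelFreeHeckeFern :=
  levelFreeHeckeFern_of_heckeFern (heckeFern_of_weak hB)

/-- B_w ⟹ W2SLF (through W2S). -/ theorem weakToStrongLF_of_weak (hB : PrimeSwitchSplit.WeakGeometricAutomorphy) : WeakToStrongLF :=
  weakToStrongLF_of_weakToStrong (weakToStrong_of_weak hB)

/-- `Langlands ⟹ B_w` (projection of direction (B); `Rec.pst` is Fontaine's pinned datum by `rfl`) — lens-4-g0's proof. -/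
private theorem weakGeometricAutomorphy_of_langlands (hL : _root_.Langlands) : PrimeSwitchSplit.WeakGeometricAutomorphy := by
  intro K _ _ n hcpt hn ℓ _ ι ρ hirr hgeo
  obtain ⟨⟨Rec⟩, h⟩ := hL K
  obtain ⟨π, hπ, hcorr⟩ := (h Rec n hn hcpt).2 ℓ ι ρ hirr ⟨hgeo.1, fun v hv => hgeo.2 v hv⟩
  exact ⟨π, hπ, hcorr.1⟩

/-- ROOT-IMPLIED certificate for the whole node: the summit implies all five pieces (no EXCESS). -/
theorem pieces_of_langlands (hL : _root_.Langlands) : HeckeFern ∧ WeakToStrongFern ∧ WeakClassicality ∧ LevelFreeHeckeFern ∧ WeakToStrongLF :=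
  have hB := weakGeometricAutomorphy_of_langlands hL
  ⟨heckeFern_of_weak hB, weakToStrong_of_weak hB, weakClassicality_of_weak hB, levelFreeHeckeFern_of_weak hB, weakToStrongLF_of_weak hB⟩

/-! ## 9. Frames: the parent's and the root's deciding theorems with the re-cut pieces -/

/-- Parent frame at U: G → LFHF → W2SLF → FERN through `AuxiliaryLevelSplit.closes`. -/
theorem closes_parent3 (hG : AuxiliaryLevelSplit.LevelFreeFern) (h₁ : LevelFreeHeckeFern) (h₂ : WeakToStrongLF) : DepthPrimeSplit.FernSpread :=
  AuxiliaryLevelSplit.closes hG (closes_target3 h₁ h₂)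

/-- Root frame of the split: `DepthPrimeSplit.closes` with FERN replaced by HF, W2S (nine binders → the summit). -/
theorem closes_root_weak (hD : DepthPrimeSplit.DyadicSeed) (hO : DepthPrimeSplit.OddPrimeSeed) (h₁ : HeckeFern) (h₂ : WeakToStrongFern)
    (hC : DepthPrimeSplit.Classicality) (hW : DepthPrimeSplit.SatakeAvatarExistence) (hP : DepthPrimeSplit.PadicMemberCompatibility)
    (hA : DepthPrimeSplit.CompatibilityAwayFromLR) (hR : DepthPrimeSplit.CanonicalReciprocityData) : _root_.Langlands :=
  DepthPrimeSplit.closes hD hO (closes_target h₁ h₂) hC hW hP hA hR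

/-- Root frame of the BYPASS: `DepthPrimeSplit.closes` with (FERN, CLASS) replaced by (HF, WCL) — the SAME eight binders, no weak ⟹ strong piece. -/
theorem closes_root_bypass (hD : DepthPrimeSplit.DyadicSeed) (hO : DepthPrimeSplit.OddPrimeSeed) (h₁ : HeckeFern) (hWc : WeakClassicality)
    (hW : DepthPrimeSplit.SatakeAvatarExistence) (hP : DepthPrimeSplit.PadicMemberCompatibility) (hA : DepthPrimeSplit.CompatibilityAwayFromLR)
    (hR : DepthPrimeSplit.CanonicalReciprocityData) : _root_.Langlands :=
  DepthPrimeSplit.closes hD hO (fernSpread_of_heckeFern_of_weakClassicality h₁ hWc) (classicality_of_weakClassicality hWc) hW hP hA hR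

/-! ## 10. Separation: the TOY WORLD «weak ≠ strong at depth 2» (𝒪 = ℤ, one Hecke variable, family {0, 2ℓ}, point ℓ = the midpoint) -/

/-- TOY WORLD = Chen–Kiming–Wiese's «general mechanism for producing eigenvalues mod p² that do not lift» (arXiv:1105.1918 p. 14: f ≡ g mod p
with eigenvalues λ ≢ μ mod p²; h = f + g is a WEAK eigenvector mod p² of eigenvalue (λ + μ)/2), here with 𝒪 = ℤ, λ = 0, μ = 2ℓ, midpoint ℓ:
EVERY integral relation `P` of the family {0, 2ℓ} (`P(0) = P(2ℓ) = 0`, so `P = X (X − 2ℓ) Q`) holds at the midpoint modulo ℓ² (`P(ℓ) = −ℓ² Q(ℓ)`: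
weakly approximated at depth 2), yet ℓ is congruent to NO member modulo ℓ² (not strongly approximated).  The dictionary `weakly_of_pro` is strict
in general; W2S has content (print: weak ≠ strong mod 9 at levels 52 / 71, loc. cit. pp. 14–15, and «we do not know whether strong and weak at a
fixed level coincide when the weight is allowed to vary», p. 14). -/
theorem toy_weak_not_strong {ℓ : ℤ} (h2 : 2 ≤ ℓ) :
    (∀ P : ℤ[X], P.eval 0 = 0 → P.eval (2 * ℓ) = 0 → ℓ ^ 2 ∣ P.eval ℓ) ∧ ¬ ℓ ^ 2 ∣ (ℓ - 0) ∧ ¬ ℓ ^ 2 ∣ (ℓ - 2 * ℓ) := by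
  have hnd : ¬ ℓ ^ 2 ∣ ℓ := fun hd => by
    have := Int.le_of_dvd (by omega) hd
    nlinarith
  refine ⟨fun P h0 h2ℓ => ?_, fun hd => hnd (by simpa using hd), fun hd => hnd ?_⟩
  · obtain ⟨P₁, rfl⟩ : (Polynomial.X - Polynomial.C (0 : ℤ)) ∣ P := Polynomial.dvd_iff_isRoot.mpr h0
    have h1 : P₁.eval (2 * ℓ) = 0 := by
      have : (2 * ℓ - 0) * P₁.eval (2 * ℓ) = 0 := by simpa [Polynomial.eval_mul] using h2ℓ
      rcases mul_eq_zero.mp this with h | h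
      · omega
      · exact h
    obtain ⟨Q, rfl⟩ : (Polynomial.X - Polynomial.C (2 * ℓ)) ∣ P₁ := Polynomial.dvd_iff_isRoot.mpr h1
    exact ⟨-Q.eval ℓ, by simp [Polynomial.eval_mul]; ring⟩
  · have e : ℓ - 2 * ℓ = -ℓ := by ring
    rwa [e, dvd_neg] at hd

end Summit.Langlands.Langlands.Theorems.WeakFern
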